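import Summits.AnomalousDissipation.AnomalousDissipation.Theorems.SolenoidalFractalHomogenisationLagrangianStepVmodLossAdjPin
import HarnessLib

/-!
# K1L_D (stmt-AnomalousDissipation-27980), (ℓ3-A) road A, (S2-fwd) glue: the FORWARD witness of `EnergyIdG` with its variational lower bound
(helper; `--supports 27980 --as helper`; prover ad-k1loc-p3 g12; the forward twin of p730365 `EnergyIdGAdj.exists_witness_duality`, obtained from the
witness-level duality `ae_duality_of_witness` of p731106 — the tool the (S2-fwd) option-1 step (d) «slow-energy accounting through corrected slow tests»
(RULING D28-26 (2)) applies to the FORWARD witness.)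

CONVENTION (D28-8′): derivative-index distortion `Torus.Visc4.conj`; constraint `∇·(G v) = 0`.

* **`EnergyIdG.exists_witness_duality`** — under `hE : EnergyIdG Tw 𝔹₀ b G U`, smooth frame slices and full nonnegativity of the quadratic form of `𝔹₀`:
  for a base time `0 ≤ s < Tw` and a `G(s)`-solenoidal `y`, the forward witness `(w, Dw)` with (i) `lossFwd (U s t) y = 2∫_{(0,t−s]} D(τ)` on `[s,Tw)`,
  `D(τ) = ∫Σ𝔹₀^{G(s+τ)}(Dw τ)(Dw τ)`, and (ii) for a.e. `τ ∈ (0,Tw−s)`: `w τ ∈ L²`, `Dw τ c ∈ L²`, and for every smooth `χ`, every `λ`,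
  `λ·(−∫⟪w τ, 𝓛^{(𝔹₀ᵀ)^{G(s+τ)},*}χ⟫ − ∫⟪w τ, 𝓛^{𝔹₀^{G(s+τ)},*}χ⟫) − λ²·∫Σ𝔹₀^{G(s+τ)}∂χ∂χ ≤ D(τ)`.
`sorry`-free; NOT a proof of any block, of K1L_D or of AD; rung F-D1.A0.
-/

set_option linter.dupNamespace false

noncomputable section

namespace Summit.AnomalousDissipation.AnomalousDissipation.Theorems.SolenoidalFractalHomogenisation.LagrangianStep.VmodDist

open Literature.Analysis Literature.Analysis.FluidPDE Literature.Analysis.FunctionSpaces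
open MeasureTheory Set Filter Function
open scoped ENNReal NNReal InnerProductSpace
open Summit.AnomalousDissipation.AnomalousDissipation.Theorems.SolenoidalFractalHomogenisation.LagrangianStep.CellClauseMod

variable {Tw : ℝ} {𝔹₀ : Torus.Visc4 (Fin 3)} {b : ℝ → VF} {G : ℝ → UnitAddTorus (Fin 3) → Matrix (Fin 3) (Fin 3) ℝ}
  {U : ℝ → ℝ → (V2 →L[ℝ] V2)}

/-- **The forward witness of `EnergyIdG` with its variational lower bound** (forward twin of `EnergyIdGAdj.exists_witness_duality`). -/
theorem EnergyIdG.exists_witness_duality (hE : EnergyIdG Tw 𝔹₀ b G U)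
    (hGs : ∀ t i j, Torus.IsSmooth (fun y => G t y i j))
    (hQ : ∀ ξ : Fin 3 → Fin 3 → ℝ, 0 ≤ ∑ l, ∑ i, ∑ c, ∑ e, 𝔹₀ i c l e * ξ c i * ξ e l)
    {s : ℝ} (hs : 0 ≤ s) (hsT : s < Tw) (y : V2) (hy : Torus.IsWeaklyDivFree (Torus.distort (G s) ((y : V2) : VF))) :
    ∃ (w : ℝ → VF) (Dw : ℝ → Fin 3 → VF),
      Torus.IsWeakTensorPassiveVectorDistortedOn 0 (Tw - s) 𝔹₀ (fun τ => b (s + τ)) (fun τ => G (s + τ)) ((y : V2) : VF) w ∧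
      (∀ c, MemLp (uncurry (Dw · c)) 2 (((volume : Measure ℝ).restrict (Ioo 0 (Tw - s))).prod volume)) ∧
      (∀ᵐ τ ∂(volume.restrict (Ioo 0 (Tw - s))), ∀ c, Torus.HasWeakPartialDeriv c (w τ) (Dw τ c)) ∧
      (∀ t ∈ Ico s Tw, lossFwd (U s t) y =
        2 * ∫ τ in Ioc 0 (t - s), ∫ x, ∑ l, ∑ i, ∑ c, ∑ e, Torus.Visc4.conj (G (s + τ) x) 𝔹₀ i c l e * (Dw τ c x) i * (Dw τ e x) l) ∧
      ∀ᵐ τ ∂(volume.restrict (Ioo 0 (Tw - s))), MemLp (w τ) 2 volume ∧ (∀ c, MemLp (Dw τ c) 2 volume) ∧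
        ∀ χ : VF, Torus.IsSmooth χ → ∀ lam : ℝ,
          lam * (-(∫ x, ⟪w τ x, Torus.viscAdjVar (fun y => Torus.Visc4.conj (G (s + τ) y) (Torus.majorTranspose 𝔹₀)) χ x⟫_ℝ)
                  - ∫ x, ⟪w τ x, Torus.viscAdjVar (fun y => Torus.Visc4.conj (G (s + τ) y) 𝔹₀) χ x⟫_ℝ)
              - lam ^ 2 * ∫ x, ∑ l, ∑ i, ∑ c, ∑ e, Torus.Visc4.conj (G (s + τ) x) 𝔹₀ i c l e
                  * (Torus.partialDeriv c χ x) i * (Torus.partialDeriv e χ x) l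
            ≤ ∫ x, ∑ l, ∑ i, ∑ c, ∑ e, Torus.Visc4.conj (G (s + τ) x) 𝔹₀ i c l e * (Dw τ c x) i * (Dw τ e x) l := by
  obtain ⟨w, Dw, hcl, hM, hD, hEq⟩ := hE s hs hsT y hy
  refine ⟨w, Dw, hcl, hM, hD, fun t ht => ?_, ?_⟩
  · unfold lossFwd; rw [hEq t ht]; ring
  · exact ae_duality_of_witness hcl hM hD (fun τ i j => hGs (s + τ) i j) hQ

end Summit.AnomalousDissipation.AnomalousDissipation.Theorems.SolenoidalFractalHomogenisation.LagrangianStep.VmodDist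

end
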